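import Mathlib
import HarnessLib
import Summits.HubbardSuperconductivity.HubbardSuperconductivity.Theorems.WeakCouplingBCSWcbcsKohnLuttingerB1gKlCertFormD

/-!
# Route `WeakCouplingBCS` — support item `WcbcsKohnLuttingerB1g` (stmt-HubbardSuperconductivity-0158):
# gluing window certificates of adjacent chemical-potential windows

A window record certifies `B1g` dominance uniformly on `[c.mub, c.mua]` (`klb1gd_window_U`).  Records are kept to `≤ 400` lines, so a long
window is covered by several records on ADJACENT windows; this file glues their conclusions: if two μ-uniform dominance statements hold on
`[a₁, b₁]` and `[a₂, b₂]` with `a₂ ≤ b₁`, then dominance with the smaller margin holds on `[a₁, b₂]` (`klb1gd_dominance_union`), and the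
record-level form for two / three accepted records with certified enclosures (`klb1gd_window_U_append`, `klb1gd_window_U_append3`).
Pure bookkeeping over the reals; no analysis.
-/

noncomputable section

-- the tree's namespace `Summit.<Summit>.<Problem>.Theorems` repeats the summit name by design (D-0017)
set_option linter.dupNamespace false

namespace Summit.HubbardSuperconductivity.HubbardSuperconductivity.Theorems

open Literature.MathematicalPhysics.QuantumLattice CwKLChiralWindow

/-- The μ-uniform `B1g`-dominance statement on a window `[a, b]` with margin `γ` (all weak couplings `0 < U < 1`). [folklore] -/
theorem klb1gd_dominance_union {a₁ b₁ a₂ b₂ γ₁ γ₂ : ℝ} (hadj : a₂ ≤ b₁)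
    (h₁ : ∀ μ ∈ Set.Icc a₁ b₁, ∀ U ∈ Set.Ioo (0 : ℝ) 1, ∀ χ : D4Irrep, χ ≠ D4Irrep.B1g →
      channelInf (squareDispersion 1 0) μ U D4Irrep.B1g + γ₁ * U ^ 2 ≤ channelInf (squareDispersion 1 0) μ U χ)
    (h₂ : ∀ μ ∈ Set.Icc a₂ b₂, ∀ U ∈ Set.Ioo (0 : ℝ) 1, ∀ χ : D4Irrep, χ ≠ D4Irrep.B1g →
      channelInf (squareDispersion 1 0) μ U D4Irrep.B1g + γ₂ * U ^ 2 ≤ channelInf (squareDispersion 1 0) μ U χ) :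
    ∀ μ ∈ Set.Icc a₁ b₂, ∀ U ∈ Set.Ioo (0 : ℝ) 1, ∀ χ : D4Irrep, χ ≠ D4Irrep.B1g →
      channelInf (squareDispersion 1 0) μ U D4Irrep.B1g + min γ₁ γ₂ * U ^ 2 ≤ channelInf (squareDispersion 1 0) μ U χ := by
  intro μ hμ U hU χ hχ
  have hU2 : 0 ≤ U ^ 2 := sq_nonneg U
  by_cases hle : μ ≤ b₁
  · have h := h₁ μ ⟨hμ.1, hle⟩ U hU χ hχ
    have hm : min γ₁ γ₂ * U ^ 2 ≤ γ₁ * U ^ 2 := mul_le_mul_of_nonneg_right (min_le_left _ _) hU2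
    linarith
  · push Not at hle
    have h := h₂ μ ⟨le_trans hadj hle.le, hμ.2⟩ U hU χ hχ
    have hm : min γ₁ γ₂ * U ^ 2 ≤ γ₂ * U ^ 2 := mul_le_mul_of_nonneg_right (min_le_right _ _) hU2
    linarith

/-- **Two adjacent window records.** If `c₁`, `c₂` are accepted by `checkB1gD`, their certified enclosures hold, and `c₂.mub ≤ c₁.mua`,
then `B1g` dominates uniformly on `[c₁.mub, c₂.mua]` with margin `min c₁.gamma c₂.gamma · U²`. [folklore] -/
theorem klb1gd_window_U_append (c₁ c₂ : KLCert) (h₁ : c₁.checkB1gD = true) (h₂ : c₂.checkB1gD = true)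
    (hE₁ : c₁.EnclosuresB1g) (hE₂ : c₂.EnclosuresB1g) (hadj : c₂.mub ≤ c₁.mua) :
    ∀ μ ∈ Set.Icc ((c₁.mub : ℚ) : ℝ) ((c₂.mua : ℚ) : ℝ), ∀ U ∈ Set.Ioo (0 : ℝ) 1, ∀ χ : D4Irrep, χ ≠ D4Irrep.B1g →
      channelInf (squareDispersion 1 0) μ U D4Irrep.B1g + min ((c₁.gamma : ℚ) : ℝ) ((c₂.gamma : ℚ) : ℝ) * U ^ 2 ≤
        channelInf (squareDispersion 1 0) μ U χ :=
  klb1gd_dominance_union (by exact_mod_cast hadj) (klb1gd_window_U c₁ h₁ hE₁) (klb1gd_window_U c₂ h₂ hE₂)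

/-- **Three adjacent window records** (`c₂.mub ≤ c₁.mua`, `c₃.mub ≤ c₂.mua`): dominance on `[c₁.mub, c₃.mua]` with margin
`min (min c₁.gamma c₂.gamma) c₃.gamma · U²`. [folklore] -/
theorem klb1gd_window_U_append3 (c₁ c₂ c₃ : KLCert) (h₁ : c₁.checkB1gD = true) (h₂ : c₂.checkB1gD = true)
    (h₃ : c₃.checkB1gD = true) (hE₁ : c₁.EnclosuresB1g) (hE₂ : c₂.EnclosuresB1g) (hE₃ : c₃.EnclosuresB1g)
    (h12 : c₂.mub ≤ c₁.mua) (h23 : c₃.mub ≤ c₂.mua) :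
    ∀ μ ∈ Set.Icc ((c₁.mub : ℚ) : ℝ) ((c₃.mua : ℚ) : ℝ), ∀ U ∈ Set.Ioo (0 : ℝ) 1, ∀ χ : D4Irrep, χ ≠ D4Irrep.B1g →
      channelInf (squareDispersion 1 0) μ U D4Irrep.B1g +
          min (min ((c₁.gamma : ℚ) : ℝ) ((c₂.gamma : ℚ) : ℝ)) ((c₃.gamma : ℚ) : ℝ) * U ^ 2 ≤
        channelInf (squareDispersion 1 0) μ U χ :=
  klb1gd_dominance_union (by exact_mod_cast h23) (klb1gd_window_U_append c₁ c₂ h₁ h₂ hE₁ hE₂ h12) (klb1gd_window_U c₃ h₃ hE₃)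

end Summit.HubbardSuperconductivity.HubbardSuperconductivity.Theorems

end
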